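import Summits.ResolutionOfSingularities.ResolutionOfSingularities.Theorems.PAlterationPialtNormalizationInConverse
import Summits.ResolutionOfSingularities.ResolutionOfSingularities.Theorems.PAlterationAssemblyLevels
import Literature.AlgebraicGeometry.Resolution.SurfaceResolutionReduction
import HarnessLib

/-!
# `Pialt` (crux stmt-ResolutionOfSingularities-0555), line `SketchIdeator2` / Card A: RR normalisations

Stub `stub_normalizeRR` of the lead's skeleton `radicially-regular-endgame` (helper file,
`--supports stmt-ResolutionOfSingularities-0555`; does not close the item).

Call an integral scheme `Z` **radicially regular (RR)** if an integral regular scheme `W` maps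
onto it by a finite, universally injective, surjective morphism `W → Z`.

**Statement (`stub_normalizeRR`).** For `Z₀` integral, locally of finite type over a field `k`
and RR (through `h₀ : W → Z₀`), there is a finite birational `ν : Z → Z₀` with `Z` integral,
NORMAL and again RR.

**Proof.** Take the normalisation `Z := Z₀^ν`, `ν := normalizationι Z₀` (Mathlib's relative
normalisation of `Spec K(Z₀) → Z₀`): it is finite (E. Noether, `isFinite_normalizationι` with
`NoetherFiniteIntegralClosure_holds`), birational (`isBirational_normalizationι`), integral, and
normal (`isIntegrallyClosed_stalk_normalization`). The regular `W` is normal (Matsumura 19.4,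
`isIntegrallyClosed_of_isRegularLocalRing`) and `h₀` is finite dominant, so the comparison map
identifies `W` with the normalisation `Z₀^{K(W)}` of `Z₀` in `K(W)`
(`exists_isIso_comparison_of_normal`). The universal property of the relative normalisation
(Mathlib `Scheme.Hom.normalizationDesc`, for `Spec K(W) → Spec K(Z₀) → Z₀^ν → Z₀`) gives an
integral dominant `δ : Z₀^{K(W)} → Z₀^ν` over `Z₀` (`exists_hom_normalizationIn_normalization`),
whence `h : W ≅ Z₀^{K(W)} → Z₀^ν` with `h ≫ ν = h₀` (`exists_lift_normalization`). Then `h` is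
finite (`h ≫ ν = h₀` finite, `ν` separated), universally injective (left cancellation,
`universallyInjective_of_comp`) and surjective (dominant with closed image).
-/

set_option linter.dupNamespace false -- mandated namespace of this single-conjunct summit

noncomputable section

open CategoryTheory CategoryTheory.Limits AlgebraicGeometry TopologicalSpace
open Literature.AlgebraicGeometry.Resolution
open Literature.AlgebraicGeometry.Motives

namespace Summit.ResolutionOfSingularities.ResolutionOfSingularities.Theorems.Pialt.RadiciallyRegular

/-- **The normalisation of `X` in an extension `L ⊇ K(X)` maps to the normalisation `X^ν`.**
For an integral scheme `X` and a field extension `L` of `K(X)`, the universal property of the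
relative normalisation (Mathlib `Scheme.Hom.normalizationDesc`) applied to the factorisation
`Spec L → Spec K(X) → X^ν → X` of `Spec L → X` yields an integral, dominant
`δ : X^L → X^ν` over `X`. [folklore] -/
theorem exists_hom_normalizationIn_normalization (X : Scheme.{0}) [IsIntegral X] (L : Type)
    [Field L] [Algebra X.functionField L] :
    ∃ δ : normalizationIn X L ⟶ normalization X,
      δ ≫ normalizationι X = normalizationInι X L ∧ IsIntegralHom δ ∧ IsDominant δ := by
  -- `Spec L → Spec K(X) → X^ν`, typed at `normalization X` so that the instances carried by
  -- `normalizationι X` are found syntactically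
  let ι : Spec (.of L) ⟶ Spec X.functionField :=
    Spec.map (CommRingCat.ofHom (algebraMap X.functionField L))
  let τ : Spec X.functionField ⟶ normalization X := (fromSpecFunctionField X).toNormalization
  have H : fromSpecExtension X L = (ι ≫ τ) ≫ normalizationι X := by
    rw [Category.assoc]
    show _ = ι ≫ (fromSpecFunctionField X).toNormalization ≫
      (fromSpecFunctionField X).fromNormalization
    rw [Scheme.Hom.toNormalization_fromNormalization]
    rfl
  -- the universal property of `X^L = (Spec L → X).normalization`
  let δ : normalizationIn X L ⟶ normalization X :=
    (fromSpecExtension X L).normalizationDesc _ _ H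
  have hδ : δ ≫ normalizationι X = normalizationInι X L :=
    (fromSpecExtension X L).normalizationDesc_comp _ _ H
  have hδ' : (fromSpecExtension X L).toNormalization ≫ δ = ι ≫ τ :=
    (fromSpecExtension X L).toNormalization_normalizationDesc _ _ H
  have hint : IsIntegralHom δ :=
    inferInstanceAs (IsIntegralHom ((fromSpecExtension X L).normalizationDesc _ _ H))
  -- dominance: `Spec L → Spec K(X)` is onto (one point) and `Spec K(X) → X^ν` is dominant
  haveI : Surjective ι := ⟨fun _ => ⟨IsLocalRing.closedPoint L,
    Subsingleton.elim (α := PrimeSpectrum X.functionField) _ _⟩⟩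
  haveI : IsDominant τ := inferInstanceAs (IsDominant (fromSpecFunctionField X).toNormalization)
  have hdomc : IsDominant ((fromSpecExtension X L).toNormalization ≫ δ) := by
    rw [hδ']
    infer_instance
  have hdom : IsDominant δ :=
    IsDominant.of_comp (fromSpecExtension X L).toNormalization δ (H := hdomc)
  exact ⟨δ, hδ, hint, hdom⟩

/-- **A finite dominant `h₀ : W → Z₀` from a normal `W` lifts to the normalisation.** For
integral `W`, `Z₀` with `Z₀` locally of finite type over a field, `h₀` finite dominant and `W`
normal, there is an integral dominant `h : W → Z₀^ν` with `h ≫ ν = h₀`: compose the inverse of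
the comparison isomorphism `Z₀^{K(W)} ≅ W` (`exists_isIso_comparison_of_normal`) with
`Z₀^{K(W)} → Z₀^ν` (`exists_hom_normalizationIn_normalization`). [folklore] -/
theorem exists_lift_normalization (k : Type) [Field k] (Z₀ W : Scheme.{0}) [IsIntegral Z₀]
    [IsIntegral W] (f₀ : Z₀ ⟶ Spec (.of k)) [LocallyOfFiniteType f₀] (h₀ : W ⟶ Z₀)
    [IsFinite h₀] [IsDominant h₀] (hWn : ∀ w : W, IsIntegrallyClosed (W.presheaf.stalk w)) :
    ∃ h : W ⟶ normalization Z₀,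
      h ≫ normalizationι Z₀ = h₀ ∧ IsIntegralHom h ∧ IsDominant h := by
  obtain ⟨φ, hφ, hcomp, -⟩ := exists_isIso_comparison_of_normal k Z₀ W f₀ h₀ hWn
  haveI := hφ
  obtain ⟨δ, hδ, hint, hdom⟩ :=
    exists_hom_normalizationIn_normalization Z₀ (FunctionFieldOver h₀)
  haveI := hint
  haveI := hdom
  refine ⟨inv φ ≫ δ, ?_, inferInstance, inferInstance⟩
  rw [Category.assoc, hδ, ← hcomp, IsIso.inv_hom_id_assoc]

/-- **Radicially regular schemes have radicially regular normalisations** (stub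
`stub_normalizeRR` of the line `SketchIdeator2` / Card A). For `Z₀` integral, locally of finite
type over a field, dominated by an integral regular `W` through a finite universally injective
surjective `h₀ : W → Z₀`, the normalisation `Z₀^ν → Z₀` is finite (E. Noether) and birational,
`Z₀^ν` is integral and normal, and `h₀` factors through a finite, universally injective,
surjective `W → Z₀^ν` (universal property of the normalisation for the dominant `h₀` from the
normal `W`). [folklore] -/
theorem stub_normalizeRR (k : Type) [Field k] (Z₀ : Scheme.{0}) (f₀ : Z₀ ⟶ Spec (.of k))
    [LocallyOfFiniteType f₀] [IsIntegral Z₀]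
    (h : ∃ (W : Scheme.{0}) (h₀ : W ⟶ Z₀), IsIntegral W ∧ Scheme.IsRegular W ∧ IsFinite h₀ ∧
      UniversallyInjective h₀ ∧ Function.Surjective h₀.base) :
    ∃ (Z : Scheme.{0}) (ν : Z ⟶ Z₀), IsFinite ν ∧ IsBirational ν ∧ IsIntegral Z ∧
      (∀ z : Z, IsIntegrallyClosed (Z.presheaf.stalk z)) ∧
      ∃ (W : Scheme.{0}) (h : W ⟶ Z), IsIntegral W ∧ Scheme.IsRegular W ∧ IsFinite h ∧
        UniversallyInjective h ∧ Function.Surjective h.base := by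
  obtain ⟨W, h₀, hW, hWreg, hfin, hui, hsurj⟩ := h
  haveI := hW
  haveI := hfin
  haveI := hui
  haveI : Surjective h₀ := ⟨hsurj⟩
  -- the normalisation is finite (E. Noether)
  haveI : IsFinite (normalizationι Z₀) :=
    isFinite_normalizationι Z₀ NoetherFiniteIntegralClosure_holds f₀
  -- `W` is normal (regular local rings are integrally closed)
  have hWn : ∀ w : W, IsIntegrallyClosed (W.presheaf.stalk w) := fun w =>
    haveI := hWreg w
    isIntegrallyClosed_of_isRegularLocalRing _
  -- lift `h₀` through the normalisation
  obtain ⟨h, hh, hint, hdom⟩ := exists_lift_normalization k Z₀ W f₀ h₀ hWn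
  haveI := hint
  haveI := hdom
  haveI : IsFinite (h ≫ normalizationι Z₀) := by
    rw [hh]
    infer_instance
  haveI : IsFinite h := IsFinite.of_comp h (normalizationι Z₀)
  haveI : UniversallyInjective (h ≫ normalizationι Z₀) := by
    rw [hh]
    infer_instance
  haveI : UniversallyInjective h := universallyInjective_of_comp h (normalizationι Z₀)
  have hs : Surjective h :=
    surjective_of_isDominant_of_isClosed_range h h.isClosedMap.isClosed_range
  exact ⟨normalization Z₀, normalizationι Z₀, inferInstance, isBirational_normalizationι Z₀ f₀,
    inferInstance, isIntegrallyClosed_stalk_normalization Z₀, W, h, hW, hWreg, inferInstance,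
    inferInstance, hs.1⟩

end Summit.ResolutionOfSingularities.ResolutionOfSingularities.Theorems.Pialt.RadiciallyRegular

end
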